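import Summits.HodgeConjecture.HodgeConjecture.Theorems.F0P3cStCharTSEPTraces              -- ★ FILE F (F0P3a-p06): `epShape_eq`, conjugate-character kit; brings ★ (G3)-EXPLICIT, ★ INDIC, ★ CLASS-LINEAR, ★ ST-TWIST
import Summits.HodgeConjecture.HodgeConjecture.Theorems.F0P3cStCharTSPSLevels              -- (C3b) (this seat): the levels `(c, c, 2c)` of `i_G(χ₁, χ₂)`
import Summits.HodgeConjecture.HodgeConjecture.Theorems.F0P3cStCharTSNoTrivialConstituent -- (C2) ★ p853261 (this seat): no trivial-action constituent in case (2) ∕ l.d.s.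
import Summits.HodgeConjecture.HodgeConjecture.Theorems.F0P3cStCharTSPSTwist              -- (C1) ★ p853293 (this seat): «PS-TWIST»
import Summits.HodgeConjecture.HodgeConjecture.Theorems.F0P3cStCharTSStLabels             -- ★ B1 milieu: N1 → N2 → N3 holds (`U3PrincipalSeriesLengthLeTwo`)
import Literature.NumberTheory.Automorphic.EulerPoincareLengthTwoDichotomy                   -- ★ E1-28 p853125 (this seat): `IrrClass.ep_eq_zero_of_constituents_pair`
import Literature.NumberTheory.Automorphic.UnitaryParahoricLevelsGenerateThree               -- ★ (G8) p853187 (this seat): `K₀ ⊔ K₁ = ⊤` in the model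
import HarnessLib

/-!
# «EP-CROSS (i)»: the Euler–Poincaré function of `G_v` is traceless on the case-(2) constituents `π²(ξ), πⁿ(ξ)`, hence so are the EP pseudo-coefficients
# `f_{St ψ}`, `f_{det ψ}` — the `EPF × PI2F` cells of `h61bRest` (E1 ROW 35; Rogawski 1990 Prop. 12.6.1 (b), §12.2 (2); Kottwitz 1988 §2)

Cell `pub/hodgecm-mathlib`, crux H413 = `stmt-HodgeConjecture-24833`, LH6 leaf `Cruxes/H413/Lines/F0_P3c_StCharTSPaydown.lean`, organ (S-𝔑) `stub_EllipticInputs`,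
consequent 3 `h61bRest` ([Rogawski1990, Prop. 12.6.1 (b)] outside the EP family); E1 row 35 «EP-CROSS (i) @ DATUM» (keeper F0P3a-p03 (g29); seat LH6-p03 (g9)).
THEOREMS ONLY (`--supports`, `--as helper`); no `def`, no instance, no notation, no `sorry`.  Letters of ★ (G3)-EXPLICIT (`w hw eA heA hd g₁ hg₁ K0 K1 I hK0 hK1 hI
fG hfG`), ★ ST-PIN (`ι hιc hι detZ hdetZ`), NF1's case-(2) data (`μv`, `IsQuadraticCharExtension`, `η₁ η₂`) with the LABELS of the organ pin `hKeysJH`∕`eLab`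
(`KeysCaseTwoLabels`: constituents of `i_G(χ_ξ)` EXACTLY `{a, b}`, `a ≠ b`) as hypotheses.

MATHEMATICS.  `Tr σ(f_EP^G) = dim σ^{K0} + dim σ^{K1} − dim σ^{I}` (★ INDIC).  For `σ ∈ JH(i_G(χ_ξ))`: the levels of `i_G(χ_ξ)` are `(1,1,2)` or `(0,0,0)` ((C3b)
«PS-LEVELS»), `i_G(χ_ξ)` has length two (★ N3, in house over ★ N1 → N2) with constituents exactly `{a, b}` and NEITHER is a trivial-action class ((C2) ★), and
`K0 ⊔ K1 = G_v` (★ (G8) along `eA`) — so ★ E1-28 gives `Tr σ(f_EP^G) = 0` (levels `(1,1,2)`), resp. ★ JH-PAIR-RANKS gives it at levels `(0,0,0)`.  Twisting: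
`Tr σ(conj(ψ′∘detZ)·f_EP) = Tr (σ ⊗ conj ψ′∘detZ)(f_EP)` (★ CLASS-LINEAR) and `σ ⊗ conj ψ′∘detZ ∈ JH(i_G(χ_{ξ′}))`, `ξ′ = (η₁, η₂·conj ψ′∘ι)` ((C1) ★ PS-TWIST) —
again case (2): so `Tr σ(f_{det ψ′}) = Tr σ(f_{St ψ′}) = 0` for the EP pseudo-coefficients `f_{det ψ′} = conj(ψ′∘detZ)·f_EP`, `f_{St ψ′} = −f_{det ψ′}` of ★ (G5).
With ★ PCT this is `⟨χ_σ, χ_{St ψ′}⟩_e = ⟨χ_σ, χ_{ψ′∘det}⟩_e = 0`: Prop. 12.6.1 (b) holds VACUOUSLY on `EPF × PI2F` — no `c`-function, no [K] engine.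

* §1 `sup_levels_eq_top` (★ (G8) pulled back along `eA`) · §2 **`smoothTrace_fG_eq_zero_of_caseTwoLabels`** · §3 **`smoothTrace_conj_detZ_mul_fG_eq_zero_of_caseTwoLabels`**,
  **`smoothTrace_neg_conj_detZ_mul_fG_eq_zero_of_caseTwoLabels`** (labels supplied for every `(η₁, η₂)`, the shape of pin `hKeysJH`).

HONEST LABEL: count-neutral until a desk-priced rider re-letters `h61bRest`; h413 OPEN; HC_CM is proved only modulo the 7 printed citations (2 remaining: hLiu418 =
stmt-HodgeConjecture-24832, h413 = stmt-HodgeConjecture-24833) until rung 0 closes.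
## References
* [Rogawski1990] J. D. Rogawski, *Automorphic Representations of Unitary Groups in Three Variables*, Ann. of Math. Stud. 123 (1990), §12.6 Prop. 12.6.1 (b) p. 188; §12.2 (2) pp. 173–174.
* [Kottwitz1988] R. E. Kottwitz, *Tamagawa numbers*, Ann. of Math. 127 (1988), §2 Theorem 2.
* [Borel1976] A. Borel, *Admissible representations … fixed under an Iwahori subgroup*, Invent. Math. 35 (1976), §3–§4.
* [BushnellHenniart2006] C. J. Bushnell, G. Henniart, *The Local Langlands Conjecture for GL(2)* (2006), §9.5 (9.5.1) p. 65.
-/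

/-!
# ED. 2 — the l.d.s. family: `Tr σ(f_EP^G) = Tr σ(f_{St ψ}) = Tr σ(f_{det ψ}) = 0` on the constituents of a REDUCIBLE `i_G(χ₁, χ₂)`, `χ₁|_{F^×} = 1`
# (the `EPF × LDS` cells of `h61bRest`; Rogawski 1990 Prop. 12.6.1 (b), §12.2 (3); Kottwitz 1988 §2) — LEDGER 35-(C4), keeper F0P3a-p03 (g30)

§1–§3 (ED. 1, ★ p853464) are byte-identical.  APPENDED: §4 **`smoothTrace_fG_eq_zero_of_reducible`** — the LABEL-FREE core: for ANY character `χ` of `T` with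
`i_G(χ)` of length two (`hlen`, ★ N3's shape), REDUCIBLE (`hred : ∃ N, N ≠ ⊥ ∧ N ≠ ⊤`, the shape of the organ's reducibility pins) and without trivial-action
constituents (`hnt`, (C2)'s heads, read at the literal carrier), `Tr σ(f_EP^G) = 0` for every constituent `σ` — ★ INDIC + (C3b) levels `(1,1,2)`∕`(0,0,0)` + ★ E1-28 §4
(ED. 2, p853550: `IrrClass.ep_eq_zero_of_isConstituentOf_of_reducible`, `IrrClass.finrank_fixedPoints_eq_zero_of_isConstituentOf_of_reducible`; no `a ≠ b` needed) —
with the l.d.s. corollary **`smoothTrace_fG_eq_zero_of_ldsReducible`** (`χ = (χ₁, χ₂)`, `χ₁|_{F^×} = 1` via (C2) `…_fixedTrivial`); §5 **`smoothTrace_epCoeff_eq_zero_of_lds`** —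
the twisted cells: ★ CLASS-LINEAR + (C1) `isConstituentOf_twist_pair` (the twist moves only the second letter, so `hfix` persists; reducibility asked for every
continuous second letter, `hK3` — [Rogawski1990, §12.2 (3)] depends on `χ₁` alone).  (§2's case-(2) head is the same core at `χ_ξ` with reducibility from its labels,
★ `exists_ne_bot_ne_top_of_constituents_pair`; it keeps its ED. 1 proof.)  With ★ PCT: Prop. 12.6.1 (b) holds VACUOUSLY on `EPF × {PI2F, LDS}` at an unramified `v`.
HONEST LABEL: count-neutral helpers; 12.6.1 (b)-rest = PRINT of record (T15-39); h413 OPEN; HC_CM is proved only modulo the 7 printed citations until rung 0 closes.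
-/

set_option autoImplicit false
-- the mandated namespace has the single-problem summit's repeated segment (`HodgeConjecture.HodgeConjecture`)
set_option linter.dupNamespace false

noncomputable section

open NumberField IsDedekindDomain MeasureTheory Topology
open scoped Matrix MatrixGroups NNReal WithZero ComplexConjugate
open Literature.NumberTheory.Automorphic Literature.NumberTheory.Automorphic.UnitaryGroup
open Literature.NumberTheory.Rogawski1990 Literature.NumberTheory.GaloisRepresentations

namespace Summit.HodgeConjecture.HodgeConjecture.Cruxes.H413.F0P3cStCharTSEPCross

open Summit.HodgeConjecture.HodgeConjecture.Cruxes.H413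
open Summit.HodgeConjecture.HodgeConjecture.Cruxes.H413.F0P3cStCharTSEPGlueGExplicit
open Summit.HodgeConjecture.HodgeConjecture.Cruxes.H413.F0P3cStCharTSEPTraces
open Summit.HodgeConjecture.HodgeConjecture.Cruxes.H413.F0P3cStCharTSPSLevels
open Summit.HodgeConjecture.HodgeConjecture.Cruxes.H413.F0P3cStCharTSNoTrivialConstituent
open Summit.HodgeConjecture.HodgeConjecture.Cruxes.H413.F0P3cStCharTSPSTwist
open Summit.HodgeConjecture.HodgeConjecture.Cruxes.H413.F0P3cStCharTSScTracePackage (isAdmissible_smoothIrrep)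

variable (L : Type) [Field L] [NumberField L] [IsCMField L] (v : HeightOneSpectrum (𝓞 ↥(maximalRealSubfield L)))
  (w : PlacesOver L v) (hw : IsCMField.complexConj L • w.1 = w.1)
  (eA : Gqs L v ≃ₜ* ↥(unitaryGroupOfForm (galAdicCompletionMap (L := L) (IsCMField.complexConj L) hw) ((StdForm.antidiagonal 3).over (w.1.adicCompletion L))))
  (heA : ∀ g : Gqs L v,
    ((eA g : ↥(unitaryGroupOfForm (galAdicCompletionMap (L := L) (IsCMField.complexConj L) hw) ((StdForm.antidiagonal 3).over (w.1.adicCompletion L)))) : GL (Fin 3) (w.1.adicCompletion L)) =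
      ((localNonsplitEquiv (IsCMField.complexConj L) (qsForm L) (IsCMField.complexConj_ne_one L) w hw g :
        ↥(unitaryGroupOfForm (galAdicCompletionMap (L := L) (IsCMField.complexConj L) hw) (placeForm (qsForm L) w.1))) : GL (Fin 3) (w.1.adicCompletion L)))
  (hns : ∀ w' : PlacesOver L v, IsCMField.complexConj L • w'.1 = w'.1) {ϖ : w.1.adicCompletion L}
  (hd : HermitianLattice.UnramifiedLocalConjDatum (galAdicCompletionMap (L := L) (IsCMField.complexConj L) hw) ϖ)
  (g₁ : GL (Fin 3) (w.1.adicCompletion L)) (hg₁ : (g₁ : Matrix (Fin 3) (Fin 3) (w.1.adicCompletion L)) = Matrix.diagonal ![(1 : w.1.adicCompletion L), 1, ϖ])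
  (K0 K1 I : Subgroup (Gqs L v))
  (hK0 : K0 = ((glInt 3 (w.1.adicCompletion L)).subgroupOf
    (unitaryGroupOfForm (galAdicCompletionMap (L := L) (IsCMField.complexConj L) hw) ((StdForm.antidiagonal 3).over (w.1.adicCompletion L)))).comap
      eA.toMulEquiv.toMonoidHom)
  (hK1 : K1 = (((glInt 3 (w.1.adicCompletion L)).map (MulAut.conj g₁).toMonoidHom).subgroupOf
    (unitaryGroupOfForm (galAdicCompletionMap (L := L) (IsCMField.complexConj L) hw) ((StdForm.antidiagonal 3).over (w.1.adicCompletion L)))).comap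
      eA.toMulEquiv.toMonoidHom)
  (hI : I = K0 ⊓ K1)
  [MeasurableSpace (Gqs L v)] [BorelSpace (Gqs L v)] (νQv : Measure (Gqs L v)) [νQv.IsHaarMeasure]
  (fG : Gqs L v → ℂ)
  (hfG : fG = fun g => (((νQv K0).toReal : ℂ))⁻¹ * (K0 : Set (Gqs L v)).indicator (fun _ => (1 : ℂ)) g +
    (((νQv K1).toReal : ℂ))⁻¹ * (K1 : Set (Gqs L v)).indicator (fun _ => (1 : ℂ)) g -
    (((νQv I).toReal : ℂ))⁻¹ * (I : Set (Gqs L v)).indicator (fun _ => (1 : ℂ)) g)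

/-! ## §1 `K0 ⊔ K1 = ⊤` in `G_v` (★ (G8) along `eA`) -/

omit [MeasurableSpace (Gqs L v)] [BorelSpace (Gqs L v)] in
include hd hg₁ hK0 hK1 in
/-- **The two vertex stabilisers generate `G_v`**: ★ (G8) `K₀ ⊔ K₁ = ⊤` in the model `U(Φ₃)(L_w)`, pulled back along the isomorphism `eA` (Mathlib `Subgroup.comap_sup_eq`).
[cite: Kottwitz1988, §2] -/
theorem sup_levels_eq_top : K0 ⊔ K1 = ⊤ := by
  rw [hK0, hK1, Subgroup.comap_sup_eq (f := eA.toMulEquiv.toMonoidHom) _ _ eA.toMulEquiv.surjective,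
    HermitianLattice.UnramifiedLocalConjDatum.glInt_subgroupOf_sup_conj_glInt_eq_top (galAdicCompletionMap (L := L) (IsCMField.complexConj L) hw)
      hd rfl g₁ hg₁, Subgroup.comap_top]

/-! ## §2 `Tr σ(f_EP^G) = 0` on the constituents of a case-(2) principal series -/

include heA hns hd hg₁ hK0 hK1 hI hfG in
set_option maxHeartbeats 4000000 in
set_option synthInstance.maxHeartbeats 400000 in
-- instance-path unification between `Gqs L v` and the literal carrier of ★ `cmPrincipalSeries` ((C2) is read there once, `hC2`)
/-- **`Tr σ(f_EP^G) = 0` FOR EVERY CONSTITUENT `σ` OF A CASE-(2) PRINCIPAL SERIES `i_G(χ_ξ)`, `χ_ξ = (η̃₁ μv ‖·‖^{1∕2}, η₂)`, `μv|_{F^×} = ω`**, given its labels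
(constituents exactly `{a, b}`, `a ≠ b` — the organ pin `hKeysJH`∕`eLab`).  ★ INDIC: the trace is `dim^{K0} + dim^{K1} − dim^{I}`; (C3b): the levels of `i_G(χ_ξ)` are
`(1,1,2)` — then ★ E1-28 over ★ N3 (length two), (C2) (no trivial-action constituent) and §1 — or `(0,0,0)` — then ★ JH-PAIR-RANKS.
[cite: Rogawski1990, §12.2 (2) pp. 173–174; §12.6 Prop. 12.6.1 (b) p. 188] [cite: Kottwitz1988, §2 Theorem 2] [cite: Borel1976, §3–§4] -/
theorem smoothTrace_fG_eq_zero_of_caseTwoLabels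
    (μv : (LocalRing L v)ˣ →* ℂˣ) (hμ : IsQuadraticCharExtension (conjLocal L (IsCMField.complexConj L) v) μv)
    (hμc : Continuous fun x => ((μv x : ℂˣ) : ℂ))
    (η₁ η₂ : ↥(normOneUnits (conjLocal L (IsCMField.complexConj L) v)) →* ℂˣ)
    (h1c : Continuous fun x => ((η₁ x : ℂˣ) : ℂ)) (h2c : Continuous fun x => ((η₂ x : ℂˣ) : ℂ))
    {a b : IrrClass (Gqs L v)} (hab : a ≠ b)
    (hJH : ∀ c : IrrClass (Gqs L v), c.IsConstituentOf (cmPrincipalSeries L 3 v (cmXiTorusChar L v μv η₁ η₂)) ↔ (c = a ∨ c = b))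
    {σ : IrrClass (Gqs L v)} (hσ : σ.IsConstituentOf (cmPrincipalSeries L 3 v (cmXiTorusChar L v μv η₁ η₂))) :
    σ.smoothTrace νQv fG = 0 := by
  haveI : NonarchimedeanGroup (Gqs L v) := nonarchimedeanGroup_cmLocal L 3 v
  haveI : LocallyCompactSpace (Gqs L v) := locallyCompactSpace_cmDatum_local (L := L) (N := 3) (H := qsForm L) (v := v)
  subst hI
  obtain ⟨hK0o, hK0c, hK1o, hK1c, hIo, hIc⟩ := isOpen_isCompact_epLevels L v w hw g₁ eA K0 K1 (K0 ⊓ K1) hK0 hK1 rfl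
  obtain ⟨hμ0, hμ1, hμI⟩ := measureReal_epLevels_ne_zero L v w hw g₁ eA K0 K1 (K0 ⊓ K1) hK0 hK1 rfl νQv
  -- the principal series: smooth, admissible, length two
  have hρ := F0P3U3LengthLeTwoOfEmbeds.isSmooth_cmPrincipalSeries L v (cmXiTorusChar L v μv η₁ η₂)
  have hadm := F0P3XiUnramNonsplitInstance.isAdmissible_cmPrincipalSeries L v (cmXiTorusChar L v μv η₁ η₂)
  have hN1 : U3PrincipalSeriesJacquetFiltration L := F0P3U3PrincipalSeriesJacquetFiltrationHolds.U3PrincipalSeriesJacquetFiltration_holds L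
  have hN3 : U3PrincipalSeriesLengthLeTwo L :=
    F0P3U3LengthLeTwoOfEmbeds.u3PrincipalSeriesLengthLeTwo_of_embeds L hN1
      (F0P3U3ConstituentEmbedsOfJacquet.u3PrincipalSeriesConstituentEmbeds_of_jacquetFiltration L hN1)
  have hlen : ∀ N₁ N₂ : Subrepresentation (cmPrincipalSeries L 3 v (cmXiTorusChar L v μv η₁ η₂)), ¬ (⊥ < N₁ ∧ N₁ < N₂ ∧ N₂ < ⊤) :=
    hN3 v hns _ η₂ (continuous_cmXiTorusChar_fst L v μv η₁ hμc h1c) h2c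
  -- (C2) read at `Gqs L v`: no constituent is a trivial-action class
  have hC2 : ∀ r : SmoothIrrep (Gqs L v), (IrrClass.mk r).IsConstituentOf (cmPrincipalSeries L 3 v (cmXiTorusChar L v μv η₁ η₂)) →
      ∃ (g : Gqs L v) (x : r.V), r.ρ g x ≠ x := fun r hr =>
    forall_apply_eq_false_of_isConstituentOf_caseTwo L v hns μv hμ η₁ η₂ hμc h1c h2c hr
  obtain ⟨ra, hra⟩ := IrrClass.mk_surjective a
  obtain ⟨rb, hrb⟩ := IrrClass.mk_surjective b
  have ha := hC2 ra ((hJH _).2 (Or.inl hra))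
  have hb := hC2 rb ((hJH _).2 (Or.inr hrb))
  -- the levels of `i_G(χ_ξ)` ((C3b))
  have hl0 := finrank_fixedPoints_cmPrincipalSeries_K0 L v w hw eA heA K0 hK0 (cmXiTorusChar L v μv η₁ η₂)
  have hl1 := finrank_fixedPoints_cmPrincipalSeries_K1 L v w hw eA heA hd g₁ hg₁ K0 K1 (K0 ⊓ K1) hK0 hK1 rfl (cmXiTorusChar L v μv η₁ η₂)
  have hlI := finrank_fixedPoints_cmPrincipalSeries_I L v w hw eA heA hd g₁ hg₁ K0 K1 (K0 ⊓ K1) hK0 hK1 rfl (cmXiTorusChar L v μv η₁ η₂)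
  -- the Euler–Poincaré count at a representative of `σ ∈ {a, b}`
  have key : ∀ (r : SmoothIrrep (Gqs L v)), (IrrClass.mk r = a ∨ IrrClass.mk r = b) →
      (Module.finrank ℂ (r.ρ.fixedPoints K0) : ℂ) + Module.finrank ℂ (r.ρ.fixedPoints K1) - Module.finrank ℂ (r.ρ.fixedPoints (K0 ⊓ K1)) = 0 := by
    intro r hr
    by_cases hU : ∀ t : ↥(torusU (conjLocal L (IsCMField.complexConj L) v) (cmLocalForm L 3 v)),
        (t : ↥(unitaryGroupOfForm (conjLocal L (IsCMField.complexConj L) v) (cmLocalForm L 3 v))) ∈ cmLocalIntegralLevel L 3 (qsForm L) v →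
          cmXiTorusChar L v μv η₁ η₂ t = 1
    · -- levels `(1,1,2)`: ★ E1-28
      rw [if_pos hU] at hl0 hl1 hlI
      have hgen := sup_levels_eq_top L v w hw eA hd g₁ hg₁ K0 K1 hK0 hK1
      rcases hr with hr | hr
      · have hE := (IrrClass.ep_eq_zero_of_constituents_pair hρ hlen hJH hab hr hrb (hC2 r ((hJH _).2 (Or.inl hr))) hb hK0c hK1c hIc hgen hl0 hl1 hlI).1
        have hc := congrArg (fun z : ℤ => (z : ℂ)) hE
        push_cast at hc
        exact hc
      · have hE := (IrrClass.ep_eq_zero_of_constituents_pair hρ hlen hJH hab hra hr ha (hC2 r ((hJH _).2 (Or.inr hr))) hK0c hK1c hIc hgen hl0 hl1 hlI).2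
        have hc := congrArg (fun z : ℤ => (z : ℂ)) hE
        push_cast at hc
        exact hc
    · -- levels `(0,0,0)`: ★ JH-PAIR-RANKS
      rw [if_neg hU] at hl0 hl1 hlI
      haveI : FiniteDimensional ℂ ((cmPrincipalSeries L 3 v (cmXiTorusChar L v μv η₁ η₂)).fixedPoints K0) := hadm.2 ⟨K0, hK0o⟩ hK0c
      haveI : FiniteDimensional ℂ ((cmPrincipalSeries L 3 v (cmXiTorusChar L v μv η₁ η₂)).fixedPoints K1) := hadm.2 ⟨K1, hK1o⟩ hK1c
      -- the `K0 ⊓ K1` instance is passed EXPLICITLY below (`⊓` on `Subgroup (Gqs L v)` vs the literal carrier does not unify at instance transparency)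
      have instI : FiniteDimensional ℂ ((cmPrincipalSeries L 3 v (cmXiTorusChar L v μv η₁ η₂)).fixedPoints (K0 ⊓ K1)) := hadm.2 ⟨K0 ⊓ K1, hIo⟩ hIc
      have hJH' : ∀ c : IrrClass (Gqs L v), c.IsConstituentOf (cmPrincipalSeries L 3 v (cmXiTorusChar L v μv η₁ η₂)) ↔ (c = b ∨ c = a) :=
        fun c => (hJH c).trans or_comm
      have hzero : Module.finrank ℂ (r.ρ.fixedPoints K0) = 0 ∧ Module.finrank ℂ (r.ρ.fixedPoints K1) = 0 ∧
          Module.finrank ℂ (r.ρ.fixedPoints (K0 ⊓ K1)) = 0 := by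
        rcases hr with hr | hr
        · exact ⟨IrrClass.finrank_fixedPoints_eq_zero_of_constituents_pair hρ hlen hJH hab hr hrb hK0c hl0,
            IrrClass.finrank_fixedPoints_eq_zero_of_constituents_pair hρ hlen hJH hab hr hrb hK1c hl1,
            @IrrClass.finrank_fixedPoints_eq_zero_of_constituents_pair _ _ _ _ _ _ _ _ _ hρ hlen _ _ hJH hab _ _ hr hrb _ hIc instI hlI⟩
        · exact ⟨IrrClass.finrank_fixedPoints_eq_zero_of_constituents_pair hρ hlen hJH' hab.symm hr hra hK0c hl0,
            IrrClass.finrank_fixedPoints_eq_zero_of_constituents_pair hρ hlen hJH' hab.symm hr hra hK1c hl1,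
            @IrrClass.finrank_fixedPoints_eq_zero_of_constituents_pair _ _ _ _ _ _ _ _ _ hρ hlen _ _ hJH' hab.symm _ _ hr hra _ hIc instI hlI⟩
      obtain ⟨e0, e1, eI⟩ := hzero
      rw [e0, e1, eI]
      norm_num
  obtain ⟨r, rfl⟩ := IrrClass.mk_surjective σ
  have hshape := IrrClass.smoothTrace_mk_epShape νQv r (isAdmissible_smoothIrrep L v hns r) hK0o hK0c hK1o hK1c hIo hIc hμ0 hμ1 hμI
  rw [hfG, epShape_eq, hshape]
  exact key r ((hJH _).1 hσ)

/-! ## §3 The twisted cells: `Tr σ(f_{det ψ′}) = Tr σ(f_{St ψ′}) = 0` for `σ ∈ JH(i_G(χ_ξ))` -/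

include heA hns hd hg₁ hK0 hK1 hI hfG in
set_option maxHeartbeats 4000000 in
set_option synthInstance.maxHeartbeats 400000 in
-- instance-path unification between `Gqs L v` and the literal carrier of ★ `cmPrincipalSeries`
/-- **THE `EPF × PI2F` CELLS AT THE TRACE LEVEL: `Tr σ(f_{det ψ′}) = 0` and `Tr σ(f_{St ψ′}) = 0`** for every constituent `σ` of a case-(2) principal series
`i_G(χ_ξ)`, `ξ = (η₁, η₂)`, and every continuous `ψ′ : Z(G_v) →* ℂˣ` — where `f_{det ψ′} = conj(ψ′∘detZ)·f_EP^G`, `f_{St ψ′} = −f_{det ψ′}` are the EP pseudo-coefficients of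
★ (G5).  ★ CLASS-LINEAR moves the character onto the class (`σ ⊗ conj ψ′∘detZ`), (C1) ★ PS-TWIST puts that class in `JH(i_G(χ_{ξ′}))`, `ξ′ = (η₁, η₂·conj ψ′∘ι)`,
whose labels `hK2` supplies (the shape of the organ pin `hKeysJH`), and §2 concludes. [cite: Rogawski1990, §12.6 Prop. 12.6.1 (b) p. 188; §12.2 (2) p. 174]
[cite: BushnellHenniart2006, §9.5 (9.5.1) p. 65] [cite: Kottwitz1988, §2 Theorem 2] -/
theorem smoothTrace_epCoeff_eq_zero_of_caseTwo
    (ι : ↥(normOneUnits (conjLocal L (IsCMField.complexConj L) v)) →* ↥(Subgroup.center (Gqs L v))) (hιc : Continuous ι)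
    (hι : ∀ z : ↥(normOneUnits (conjLocal L (IsCMField.complexConj L) v)),
      ((ι z).val.val.val : Matrix (Fin 3) (Fin 3) (LocalRing L v)) = (((z : (LocalRing L v)ˣ) : LocalRing L v)) • (1 : Matrix (Fin 3) (Fin 3) (LocalRing L v)))
    (detZ : Gqs L v →* ↥(Subgroup.center (Gqs L v)))
    (hdetZ : ∀ g : Gqs L v, ((detZ g).val.val.val : Matrix (Fin 3) (Fin 3) (LocalRing L v)) =
        (g.val.val : Matrix (Fin 3) (Fin 3) (LocalRing L v)).det • (1 : Matrix (Fin 3) (Fin 3) (LocalRing L v)))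
    (μv : (LocalRing L v)ˣ →* ℂˣ) (hμ : IsQuadraticCharExtension (conjLocal L (IsCMField.complexConj L) v) μv)
    (hμc : Continuous fun x => ((μv x : ℂˣ) : ℂ))
    (hK2 : ∀ η₁ η₂ : ↥(normOneUnits (conjLocal L (IsCMField.complexConj L) v)) →* ℂˣ,
      Continuous (fun x => ((η₁ x : ℂˣ) : ℂ)) → Continuous (fun x => ((η₂ x : ℂˣ) : ℂ)) →
        ∃ a b : IrrClass (Gqs L v), a ≠ b ∧
          ∀ c : IrrClass (Gqs L v), c.IsConstituentOf (cmPrincipalSeries L 3 v (cmXiTorusChar L v μv η₁ η₂)) ↔ (c = a ∨ c = b))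
    (η₁ η₂ : ↥(normOneUnits (conjLocal L (IsCMField.complexConj L) v)) →* ℂˣ)
    (h1c : Continuous fun x => ((η₁ x : ℂˣ) : ℂ)) (h2c : Continuous fun x => ((η₂ x : ℂˣ) : ℂ))
    {σ : IrrClass (Gqs L v)} (hσ : σ.IsConstituentOf (cmPrincipalSeries L 3 v (cmXiTorusChar L v μv η₁ η₂)))
    (ψ' : ↥(Subgroup.center (Gqs L v)) →* ℂˣ) (hψ' : Continuous ψ')
    (hopen' : IsOpen (((ψ'.comp detZ).ker : Subgroup (Gqs L v)) : Set (Gqs L v))) :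
    σ.smoothTrace νQv (fun g => conj (((ψ' (detZ g)) : ℂˣ) : ℂ) * fG g) = 0 ∧
      σ.smoothTrace νQv (fun g => -(conj (((ψ' (detZ g)) : ℂˣ) : ℂ) * fG g)) = 0 := by
  haveI : NonarchimedeanGroup (Gqs L v) := nonarchimedeanGroup_cmLocal L 3 v
  haveI : LocallyCompactSpace (Gqs L v) := locallyCompactSpace_cmDatum_local (L := L) (N := 3) (H := qsForm L) (v := v)
  obtain ⟨r, rfl⟩ := IrrClass.mk_surjective σ
  -- ★ CLASS-LINEAR: the character moves onto the class
  have hcl : (IrrClass.mk r).smoothTrace νQv (fun g => conj (((ψ' (detZ g)) : ℂˣ) : ℂ) * fG g) =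
      (IrrClass.twist (((Units.map ((starRingEnd ℂ : ℂ →+* ℂ) : ℂ →* ℂ)).comp ψ').comp detZ) (isOpen_ker_conjChar_comp L v detZ ψ' hopen')
        (IrrClass.mk r)).smoothTrace νQv fG :=
    IrrClass.smoothTrace_mk_conj_character_mul_eq νQv (ψ'.comp detZ) hopen' r (isAdmissible_smoothIrrep L v hns r) fG
  have hcln : (IrrClass.mk r).smoothTrace νQv (fun g => -(conj (((ψ' (detZ g)) : ℂˣ) : ℂ) * fG g)) =
      -((IrrClass.twist (((Units.map ((starRingEnd ℂ : ℂ →+* ℂ) : ℂ →* ℂ)).comp ψ').comp detZ) (isOpen_ker_conjChar_comp L v detZ ψ' hopen')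
        (IrrClass.mk r)).smoothTrace νQv fG) :=
    IrrClass.smoothTrace_mk_neg_conj_character_mul_eq νQv (ψ'.comp detZ) hopen' r (isAdmissible_smoothIrrep L v hns r) fG
  -- (C1): the twisted class is a constituent of the case-(2) series at `(η₁, η₂·conj ψ′∘ι)`
  have hμc' : Continuous ⇑((Units.map ((starRingEnd ℂ : ℂ →+* ℂ) : ℂ →* ℂ)).comp ψ') := continuous_conjChar ψ' hψ'
  have h2c' : Continuous fun x => (((η₂ * ((((Units.map ((starRingEnd ℂ : ℂ →+* ℂ) : ℂ →* ℂ)).comp ψ')).comp ι)) x : ℂˣ) : ℂ) := by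
    have h : Continuous fun x => (((((Units.map ((starRingEnd ℂ : ℂ →+* ℂ) : ℂ →* ℂ)).comp ψ').comp ι) x : ℂˣ) : ℂ) :=
      Units.continuous_val.comp (hμc'.comp hιc)
    simp only [MonoidHom.mul_apply, Units.val_mul]
    exact h2c.mul (by simpa only [MonoidHom.comp_apply] using h)
  obtain ⟨a, b, hab, hJH⟩ := hK2 η₁ (η₂ * ((((Units.map ((starRingEnd ℂ : ℂ →+* ℂ) : ℂ →* ℂ)).comp ψ')).comp ι)) h1c h2c'
  have hσ' := isConstituentOf_twist_xi L v ι hι detZ hdetZ μv η₁ η₂ (((Units.map ((starRingEnd ℂ : ℂ →+* ℂ) : ℂ →* ℂ)).comp ψ'))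
    (isOpen_ker_conjChar_comp L v detZ ψ' hopen') hσ
  have h0 := smoothTrace_fG_eq_zero_of_caseTwoLabels L v w hw eA heA hns hd g₁ hg₁ K0 K1 I hK0 hK1 hI νQv fG hfG μv hμ hμc η₁ _ h1c h2c' hab hJH hσ'
  refine ⟨hcl.trans h0, ?_⟩
  rw [hcln, h0, neg_zero]

/-! ## §4 (ED. 2) The label-free core over ★ E1-28 §4 and the l.d.s. family ([Rogawski1990, §12.2 (3)]) -/

include heA hns hd hg₁ hK0 hK1 hI hfG in
set_option maxHeartbeats 4000000 in
set_option synthInstance.maxHeartbeats 400000 in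
-- budget: ★ E1-28 §4 instantiated at the `cmPrincipalSeries` carrier read from `Gqs L v` (levels, compactness, generation, `hσ`), twice
/-- **`Tr σ(f_EP^G) = 0` FOR EVERY CONSTITUENT `σ` OF A REDUCIBLE PRINCIPAL SERIES `i_G(χ)` WITHOUT TRIVIAL-ACTION CONSTITUENTS** (`χ` any character of `T`;
`hlen` = ★ N3's shape, `hred : ∃ N, N ≠ ⊥ ∧ N ≠ ⊤` = the shape of the organ's reducibility pins, `hnt` = (C2)'s heads, read at the literal carrier).  ★ INDIC: the
trace is `dim^{K0} + dim^{K1} − dim^{I}` at a representative; (C3b): the levels of `i_G(χ)` are `(1,1,2)` — then ★ E1-28 §4 `ep_eq_zero_of_isConstituentOf_of_reducible`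
(`K0 ⊔ K1 = ⊤` by §1) — or `(0,0,0)` — then ★ E1-28 §4 `finrank_fixedPoints_eq_zero_of_isConstituentOf_of_reducible` thrice.
[cite: Rogawski1990, §12.2 pp. 173–174; §12.6 Prop. 12.6.1 (b) p. 188] [cite: Kottwitz1988, §2 Theorem 2] [cite: Borel1976, §3–§4] -/
theorem smoothTrace_fG_eq_zero_of_reducible (χ : ↥(torusU (conjLocal L (IsCMField.complexConj L) v) (cmLocalForm L 3 v)) →* ℂˣ)
    (hlen : ∀ N₁ N₂ : Subrepresentation (cmPrincipalSeries L 3 v χ), ¬ (⊥ < N₁ ∧ N₁ < N₂ ∧ N₂ < ⊤))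
    (hnt : ∀ r : SmoothIrrep ↥(unitaryGroupOfForm (conjLocal L (IsCMField.complexConj L) v) (cmLocalForm L 3 v)),
      (IrrClass.mk r).IsConstituentOf (cmPrincipalSeries L 3 v χ) → ∃ (g : ↥(unitaryGroupOfForm (conjLocal L (IsCMField.complexConj L) v) (cmLocalForm L 3 v))) (x : r.V), r.ρ g x ≠ x)
    (hred : ∃ N : Subrepresentation (cmPrincipalSeries L 3 v χ), N ≠ ⊥ ∧ N ≠ ⊤)
    {σ : IrrClass (Gqs L v)} (hσ : σ.IsConstituentOf (cmPrincipalSeries L 3 v χ)) :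
    σ.smoothTrace νQv fG = 0 := by
  haveI : NonarchimedeanGroup (Gqs L v) := nonarchimedeanGroup_cmLocal L 3 v
  haveI : LocallyCompactSpace (Gqs L v) := locallyCompactSpace_cmDatum_local (L := L) (N := 3) (H := qsForm L) (v := v)
  subst hI
  obtain ⟨hK0o, hK0c, hK1o, hK1c, hIo, hIc⟩ := isOpen_isCompact_epLevels L v w hw g₁ eA K0 K1 (K0 ⊓ K1) hK0 hK1 rfl
  obtain ⟨hμ0, hμ1, hμI⟩ := measureReal_epLevels_ne_zero L v w hw g₁ eA K0 K1 (K0 ⊓ K1) hK0 hK1 rfl νQv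
  have hρ := F0P3U3LengthLeTwoOfEmbeds.isSmooth_cmPrincipalSeries L v χ
  have hadm := F0P3XiUnramNonsplitInstance.isAdmissible_cmPrincipalSeries L v χ
  -- the levels of `i_G(χ)` ((C3b))
  have hl0 := finrank_fixedPoints_cmPrincipalSeries_K0 L v w hw eA heA K0 hK0 χ
  have hl1 := finrank_fixedPoints_cmPrincipalSeries_K1 L v w hw eA heA hd g₁ hg₁ K0 K1 (K0 ⊓ K1) hK0 hK1 rfl χ
  have hlI := finrank_fixedPoints_cmPrincipalSeries_I L v w hw eA heA hd g₁ hg₁ K0 K1 (K0 ⊓ K1) hK0 hK1 rfl χ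
  -- ★ INDIC at a representative
  obtain ⟨r, rfl⟩ := IrrClass.mk_surjective σ
  have hshape := IrrClass.smoothTrace_mk_epShape νQv r (isAdmissible_smoothIrrep L v hns r) hK0o hK0c hK1o hK1c hIo hIc hμ0 hμ1 hμI
  rw [hfG, epShape_eq, hshape]
  by_cases hU : ∀ t : ↥(torusU (conjLocal L (IsCMField.complexConj L) v) (cmLocalForm L 3 v)), (t : ↥(unitaryGroupOfForm (conjLocal L (IsCMField.complexConj L) v) (cmLocalForm L 3 v))) ∈ cmLocalIntegralLevel L 3 (qsForm L) v → χ t = 1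
  · -- levels `(1,1,2)`: ★ E1-28 §4
    rw [if_pos hU] at hl0 hl1 hlI
    have hgen := sup_levels_eq_top L v w hw eA hd g₁ hg₁ K0 K1 hK0 hK1
    have hE := IrrClass.ep_eq_zero_of_isConstituentOf_of_reducible hρ hlen hnt hred hK0c hK1c hIc hgen hl0 hl1 hlI hσ
    have hc := congrArg (fun z : ℤ => (z : ℂ)) hE
    push_cast at hc
    exact hc
  · -- levels `(0,0,0)`: ★ E1-28 §4, the `K0 ⊓ K1` instance passed EXPLICITLY (`⊓` on `Subgroup (Gqs L v)` vs the literal carrier does not unify at instance transparency)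
    rw [if_neg hU] at hl0 hl1 hlI
    haveI : FiniteDimensional ℂ ((cmPrincipalSeries L 3 v χ).fixedPoints K0) := hadm.2 ⟨K0, hK0o⟩ hK0c
    haveI : FiniteDimensional ℂ ((cmPrincipalSeries L 3 v χ).fixedPoints K1) := hadm.2 ⟨K1, hK1o⟩ hK1c
    have instI : FiniteDimensional ℂ ((cmPrincipalSeries L 3 v χ).fixedPoints (K0 ⊓ K1)) := hadm.2 ⟨K0 ⊓ K1, hIo⟩ hIc
    -- stated at `Gqs L v` (the rewrite below is syntactic); ★ E1-28 §4 read by `exact` (definitional unfolding of the carrier)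
    have hzero : Module.finrank ℂ (r.ρ.fixedPoints K0) = 0 ∧ Module.finrank ℂ (r.ρ.fixedPoints K1) = 0 ∧
        Module.finrank ℂ (r.ρ.fixedPoints (K0 ⊓ K1)) = 0 :=
      ⟨IrrClass.finrank_fixedPoints_eq_zero_of_isConstituentOf_of_reducible hρ hlen hred hK0c hl0 hσ,
        IrrClass.finrank_fixedPoints_eq_zero_of_isConstituentOf_of_reducible hρ hlen hred hK1c hl1 hσ,
        @IrrClass.finrank_fixedPoints_eq_zero_of_isConstituentOf_of_reducible _ _ _ _ _ _ _ _ hρ hlen hred _ hIc instI hlI _ hσ⟩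
    obtain ⟨e0, e1, eI⟩ := hzero
    rw [e0, e1, eI]
    norm_num

include heA hns hd hg₁ hK0 hK1 hI hfG in
set_option maxHeartbeats 1600000 in
set_option synthInstance.maxHeartbeats 400000 in
-- `hred`∕`hσ` read at the `cmPrincipalSeries` carrier
/-- **L.D.S.: `Tr σ(f_EP^G) = 0` for every constituent `σ` of a REDUCIBLE `i_G(χ₁, χ₂)` with `χ₁|_{F^×} = 1`** (the l.d.s. data of [Rogawski1990, §12.2 (3)]; `hred` = the shape
of the organ's outer input `hKeysRed3`): the core above with ★ N3 and (C2) `…_fixedTrivial`. [cite: Rogawski1990, §12.2 (3) p. 174; §12.6 Prop. 12.6.1 (b) p. 188] [cite: Kottwitz1988, §2 Theorem 2] -/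
theorem smoothTrace_fG_eq_zero_of_ldsReducible
    (χ₁ : (LocalRing L v)ˣ →* ℂˣ) (χ₂ : ↥(normOneUnits (conjLocal L (IsCMField.complexConj L) v)) →* ℂˣ)
    (hχ₁ : Continuous fun x => ((χ₁ x : ℂˣ) : ℂ)) (hχ₂ : Continuous fun x => ((χ₂ x : ℂˣ) : ℂ))
    (hfix : ∀ a : (LocalRing L v)ˣ, conjLocal L (IsCMField.complexConj L) v (a : LocalRing L v) = a → χ₁ a = 1)
    (hred : ∃ N : Subrepresentation (cmPrincipalSeries L 3 v (cmTorusCharPair L v χ₁ χ₂)), N ≠ ⊥ ∧ N ≠ ⊤)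
    {σ : IrrClass (Gqs L v)} (hσ : σ.IsConstituentOf (cmPrincipalSeries L 3 v (cmTorusCharPair L v χ₁ χ₂))) :
    σ.smoothTrace νQv fG = 0 := by
  have hN1 : U3PrincipalSeriesJacquetFiltration L := F0P3U3PrincipalSeriesJacquetFiltrationHolds.U3PrincipalSeriesJacquetFiltration_holds L
  have hN3 : U3PrincipalSeriesLengthLeTwo L :=
    F0P3U3LengthLeTwoOfEmbeds.u3PrincipalSeriesLengthLeTwo_of_embeds L hN1
      (F0P3U3ConstituentEmbedsOfJacquet.u3PrincipalSeriesConstituentEmbeds_of_jacquetFiltration L hN1)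
  exact smoothTrace_fG_eq_zero_of_reducible L v w hw eA heA hns hd g₁ hg₁ K0 K1 I hK0 hK1 hI νQv fG hfG (cmTorusCharPair L v χ₁ χ₂)
    (hN3 v hns χ₁ χ₂ hχ₁ hχ₂) (fun r hr => forall_apply_eq_false_of_isConstituentOf_fixedTrivial L v hns χ₁ χ₂ hχ₁ hχ₂ hfix hr) hred hσ

/-! ## §5 (ED. 2) The l.d.s. twisted cells: `Tr σ(f_{det ψ′}) = Tr σ(f_{St ψ′}) = 0` for `σ ∈ JH(i_G(χ₁, χ₂))`, `χ₁|_{F^×} = 1`, reducible -/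

include heA hns hd hg₁ hK0 hK1 hI hfG in
set_option maxHeartbeats 4000000 in
set_option synthInstance.maxHeartbeats 400000 in
-- instance-path unification between `Gqs L v` and the literal carrier of ★ `cmPrincipalSeries`
/-- **THE `EPF × LDS` CELLS AT THE TRACE LEVEL: `Tr σ(f_{det ψ′}) = 0` and `Tr σ(f_{St ψ′}) = 0`** for every constituent `σ` of an l.d.s.-type principal series
`i_G(χ₁, χ₂)` — `χ₁|_{F^×} = 1` (`hfix`), REDUCIBLE for every continuous second letter (`hK3`, the shape of the organ pin `hKeysRed3`: [Rogawski1990, §12.2 (3)] depends on `χ₁`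
alone) — and every continuous `ψ′ : Z(G_v) →* ℂˣ`.  ★ CLASS-LINEAR moves the character onto the class, (C1) ★ PS-TWIST `isConstituentOf_twist_pair` puts the twisted class in
`JH(i_G(χ₁, χ₂·conj ψ′∘ι))` — same `χ₁`, so `hfix` persists — and §4 `smoothTrace_fG_eq_zero_of_ldsReducible` concludes.
[cite: Rogawski1990, §12.6 Prop. 12.6.1 (b) p. 188; §12.2 (3) p. 174] [cite: BushnellHenniart2006, §9.5 (9.5.1) p. 65] [cite: Kottwitz1988, §2 Theorem 2] -/
theorem smoothTrace_epCoeff_eq_zero_of_lds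
    (ι : ↥(normOneUnits (conjLocal L (IsCMField.complexConj L) v)) →* ↥(Subgroup.center (Gqs L v))) (hιc : Continuous ι)
    (hι : ∀ z : ↥(normOneUnits (conjLocal L (IsCMField.complexConj L) v)),
      ((ι z).val.val.val : Matrix (Fin 3) (Fin 3) (LocalRing L v)) = (((z : (LocalRing L v)ˣ) : LocalRing L v)) • (1 : Matrix (Fin 3) (Fin 3) (LocalRing L v)))
    (detZ : Gqs L v →* ↥(Subgroup.center (Gqs L v)))
    (hdetZ : ∀ g : Gqs L v, ((detZ g).val.val.val : Matrix (Fin 3) (Fin 3) (LocalRing L v)) =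
        (g.val.val : Matrix (Fin 3) (Fin 3) (LocalRing L v)).det • (1 : Matrix (Fin 3) (Fin 3) (LocalRing L v)))
    (χ₁ : (LocalRing L v)ˣ →* ℂˣ) (hχ₁ : Continuous fun x => ((χ₁ x : ℂˣ) : ℂ))
    (hfix : ∀ a : (LocalRing L v)ˣ, conjLocal L (IsCMField.complexConj L) v (a : LocalRing L v) = a → χ₁ a = 1)
    (hK3 : ∀ χ₂' : ↥(normOneUnits (conjLocal L (IsCMField.complexConj L) v)) →* ℂˣ, Continuous (fun x => ((χ₂' x : ℂˣ) : ℂ)) →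
      ∃ N : Subrepresentation (cmPrincipalSeries L 3 v (cmTorusCharPair L v χ₁ χ₂')), N ≠ ⊥ ∧ N ≠ ⊤)
    (χ₂ : ↥(normOneUnits (conjLocal L (IsCMField.complexConj L) v)) →* ℂˣ) (hχ₂ : Continuous fun x => ((χ₂ x : ℂˣ) : ℂ))
    {σ : IrrClass (Gqs L v)} (hσ : σ.IsConstituentOf (cmPrincipalSeries L 3 v (cmTorusCharPair L v χ₁ χ₂)))
    (ψ' : ↥(Subgroup.center (Gqs L v)) →* ℂˣ) (hψ' : Continuous ψ')
    (hopen' : IsOpen (((ψ'.comp detZ).ker : Subgroup (Gqs L v)) : Set (Gqs L v))) :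
    σ.smoothTrace νQv (fun g => conj (((ψ' (detZ g)) : ℂˣ) : ℂ) * fG g) = 0 ∧
      σ.smoothTrace νQv (fun g => -(conj (((ψ' (detZ g)) : ℂˣ) : ℂ) * fG g)) = 0 := by
  haveI : NonarchimedeanGroup (Gqs L v) := nonarchimedeanGroup_cmLocal L 3 v
  haveI : LocallyCompactSpace (Gqs L v) := locallyCompactSpace_cmDatum_local (L := L) (N := 3) (H := qsForm L) (v := v)
  obtain ⟨r, rfl⟩ := IrrClass.mk_surjective σ
  -- ★ CLASS-LINEAR: the character moves onto the class
  have hcl : (IrrClass.mk r).smoothTrace νQv (fun g => conj (((ψ' (detZ g)) : ℂˣ) : ℂ) * fG g) =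
      (IrrClass.twist (((Units.map ((starRingEnd ℂ : ℂ →+* ℂ) : ℂ →* ℂ)).comp ψ').comp detZ) (isOpen_ker_conjChar_comp L v detZ ψ' hopen')
        (IrrClass.mk r)).smoothTrace νQv fG :=
    IrrClass.smoothTrace_mk_conj_character_mul_eq νQv (ψ'.comp detZ) hopen' r (isAdmissible_smoothIrrep L v hns r) fG
  have hcln : (IrrClass.mk r).smoothTrace νQv (fun g => -(conj (((ψ' (detZ g)) : ℂˣ) : ℂ) * fG g)) =
      -((IrrClass.twist (((Units.map ((starRingEnd ℂ : ℂ →+* ℂ) : ℂ →* ℂ)).comp ψ').comp detZ) (isOpen_ker_conjChar_comp L v detZ ψ' hopen')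
        (IrrClass.mk r)).smoothTrace νQv fG) :=
    IrrClass.smoothTrace_mk_neg_conj_character_mul_eq νQv (ψ'.comp detZ) hopen' r (isAdmissible_smoothIrrep L v hns r) fG
  -- (C1): the twisted class is a constituent of the l.d.s. series at `(χ₁, χ₂·conj ψ′∘ι)` — same first letter
  have hμc' : Continuous ⇑((Units.map ((starRingEnd ℂ : ℂ →+* ℂ) : ℂ →* ℂ)).comp ψ') := continuous_conjChar ψ' hψ'
  have h2c' : Continuous fun x => (((χ₂ * ((((Units.map ((starRingEnd ℂ : ℂ →+* ℂ) : ℂ →* ℂ)).comp ψ')).comp ι)) x : ℂˣ) : ℂ) := by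
    have h : Continuous fun x => (((((Units.map ((starRingEnd ℂ : ℂ →+* ℂ) : ℂ →* ℂ)).comp ψ').comp ι) x : ℂˣ) : ℂ) :=
      Units.continuous_val.comp (hμc'.comp hιc)
    simp only [MonoidHom.mul_apply, Units.val_mul]
    exact hχ₂.mul (by simpa only [MonoidHom.comp_apply] using h)
  have hσ' := isConstituentOf_twist_pair L v ι hι detZ hdetZ χ₁ χ₂ (((Units.map ((starRingEnd ℂ : ℂ →+* ℂ) : ℂ →* ℂ)).comp ψ'))
    (isOpen_ker_conjChar_comp L v detZ ψ' hopen') hσ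
  have h0 := smoothTrace_fG_eq_zero_of_ldsReducible L v w hw eA heA hns hd g₁ hg₁ K0 K1 I hK0 hK1 hI νQv fG hfG χ₁ _ hχ₁ h2c' hfix (hK3 _ h2c') hσ'
  refine ⟨hcl.trans h0, ?_⟩
  rw [hcln, h0, neg_zero]

end Summit.HodgeConjecture.HodgeConjecture.Cruxes.H413.F0P3cStCharTSEPCross

end
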